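import Literature.NumberTheory.LFunctions.StarkHadamardZeros
import HarnessLib

/-!
# Stark's comparison device for symmetric entire functions: `Re F'/F(σ) ≤ 4 Re F'/F(σ₁)` when no
# zero lies in the box near `s = 1` (abstract core of Stark 1974, Lemma 4)

Topic `Summits/QuantumAdvantage/QuantumAdvantage/Theorems`, helper for the crux `DegreeOnePrimesEscape`
(stmt-QuantumAdvantage-11543) of route `LinnikCubicClassGroups`; cell B2b-1 (linnik-cubic), PART B (the
residue lower bound R of line `subgroup-orthogonality-escape`). HONEST FRAMING: the value of this file is
a THEOREM — not summit progress.

Stark's lower bound for the residue `κ_K` of `ζ_K` ([Stark1974, Lemma 4 and (27)]) integrates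
`(log f)'(σ)`, `f(s) = s(s−1)Λ_K(s)`, from `σ = 1` to `σ₁ = 1 + δ` and bounds `Re ∑_ρ 1/(σ−ρ)` by
comparison with its value at `σ₁` ([Stark1974, Lemma 2]: for a zero `ρ` outside the box
`{Re ρ > 1 − δ, |Im ρ| < δ}`, `Re 1/(σ−ρ) ≪ Re 1/(σ₁−ρ)` uniformly in `1 ≤ σ ≤ σ₁`). This file proves the
abstract core for an ARBITRARY entire `F` with `F(1−s) = F(s)`, growth `exp(‖s‖^μ)`, `μ < 2`, zeros in
`Re s ≤ 1` and NO zero in the box: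

* `exists_hadamard_logDeriv` — the Hadamard expansion `F'/F(τ) = 2m/(τ−½) + Σₙ 2cₙ(τ−½)/(1 + cₙ(τ−½)²)`
  for all real `τ > 1` with ONE set of data `(m, cₙ)` (extracted from the proof of the tree's
  `Stark1974.re_logDeriv_nonneg_of_symmetric`, Hadamard genus zero on the even lift);
* `re_inv_sub_le_four_mul` — Stark's Lemma 2 with the constant `4`;
* `re_logDeriv_le_four_mul` — **`Re F'/F(σ) ≤ 4·Re F'/F(σ₁)`** for `1 < σ ≤ σ₁ ≤ 1 + δ`;
(The analysis helpers for the integration step — `(log‖f‖)' = Re f'/f`, the mean value inequality,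
lower bounds for `Γ_ℝ`, `Γ_ℂ` on `[1,2]` — are in the sibling file `…ResidueAnalysis.lean`.)

## References

* H. M. Stark, *Some effective cases of the Brauer–Siegel theorem*, Invent. Math. 23 (1974)
  135–152, Lemmas 2–4. [Stark1974]
-/

noncomputable section

open Complex Filter Topology Set

namespace Summit.QuantumAdvantage.QuantumAdvantage.Theorems.DegreeOnePrimesEscape

namespace Residue

open Literature.NumberTheory.LFunctions Literature.NumberTheory.LFunctions.Stark1974

/-! ### The Hadamard expansion of `F'/F` on the real axis -/

/-- **Hadamard expansion of `F'/F` right of `1`** for an entire `F` with `F(1−s) = F(s)`,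
`‖F(s)‖ ≤ C exp(‖s‖^μ)` (`μ < 2`) and zeros in `Re s ≤ 1`: there are `m : ℕ` and an absolutely summable
`c : ℕ → ℂ` such that every root `ζ` of `cₙζ² = −1` gives zeros `½ ± ζ` of `F`, and for EVERY real
`τ > 1`, with `z = τ − ½`, no factor `1 + cₙz²` vanishes and
`F'/F(τ) = 2m/z + Σₙ 2cₙz/(1 + cₙz²)`. (The proof of the tree's `Stark1974.re_logDeriv_nonneg_of_symmetric`,
with the point `σ` universally quantified.) [cite: MurtyMurty1997, Ch. 2 Prop. 6.1 (proof)] -/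
theorem exists_hadamard_logDeriv {F : ℂ → ℂ} (hF : Differentiable ℂ F)
    (hsymm : ∀ s, F (1 - s) = F s) {C μ : ℝ} (hμ : μ < 2) (hμ0 : 0 ≤ μ)
    (hgrowth : ∀ s, ‖F s‖ ≤ C * Real.exp (‖s‖ ^ μ)) (hzero : ∀ s, F s = 0 → s.re ≤ 1) :
    ∃ (m : ℕ) (c : ℕ → ℂ), Summable (fun n ↦ ‖c n‖) ∧
      (∀ n ζ, c n * ζ ^ 2 = -1 → F (1 / 2 + ζ) = 0 ∧ F (1 / 2 - ζ) = 0) ∧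
      ∀ τ : ℝ, 1 < τ →
        (∀ n, 1 + c n * ((τ : ℂ) - 1 / 2) ^ 2 ≠ 0) ∧
        logDeriv F τ = 2 * m / ((τ : ℂ) - 1 / 2) +
          ∑' n, 2 * c n * ((τ : ℂ) - 1 / 2) / (1 + c n * ((τ : ℂ) - 1 / 2) ^ 2) := by
  have hFne : ∀ s : ℂ, 1 < s.re → F s ≠ 0 := fun s hs h ↦ by linarith [hzero s h]
  -- the even function `g(z) = F(1/2 + z)`
  set g : ℂ → ℂ := fun z ↦ F (1 / 2 + z) with hg
  have hg_diff : Differentiable ℂ g := hF.comp ((differentiable_const _).add differentiable_id)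
  have hg_even : ∀ z, g (-z) = g z := fun z ↦ by
    simp only [hg]
    rw [← hsymm (1 / 2 + z)]
    congr 1
    ring
  obtain ⟨C₁, hC₁0, hC₁⟩ := growth_shift hμ0 hgrowth (1 / 2) (show μ < (μ + 2) / 2 by linarith)
  -- the even lift `G(w) = g(√w)`
  set G : ℂ → ℂ := fun w ↦ g (w ^ (2⁻¹ : ℂ)) with hGdef
  have hG_diff : Differentiable ℂ G := Newman.differentiable_comp_cpow_half hg_diff hg_even
  have hG_sq : ∀ z, G (z ^ 2) = g z := fun z ↦ Newman.comp_cpow_half_apply_sq hg_even z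
  have hG_growth : ∀ w, ‖G w‖ ≤ C₁ * Real.exp (‖w‖ ^ ((μ + 2) / 4)) := by
    intro w
    have h := hC₁ (w ^ (2⁻¹ : ℂ))
    have hn : ‖w ^ (2⁻¹ : ℂ)‖ = ‖w‖ ^ (2⁻¹ : ℝ) := by
      rw [show (2⁻¹ : ℂ) = ((2⁻¹ : ℝ) : ℂ) by push_cast; ring, Complex.norm_cpow_real]
    rw [hn, ← Real.rpow_mul (norm_nonneg _)] at h
    have he : (2⁻¹ : ℝ) * ((μ + 2) / 2) = (μ + 2) / 4 := by ring
    rwa [he] at h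
  have hρ : (μ + 2) / 4 < 1 := by linarith
  -- `G` is not identically zero
  have hG_ne : G ((3 / 2 : ℂ) ^ 2) ≠ 0 := by
    rw [hG_sq]
    simp only [hg]
    have : (1 / 2 : ℂ) + 3 / 2 = 2 := by norm_num
    rw [this]
    exact hFne 2 (by norm_num)
  obtain ⟨m, G₁, hG₁_diff, hG₁0, hG₁_eq⟩ := exists_eq_pow_mul hG_diff hG_ne
  obtain ⟨C₂, hC₂⟩ := growth_of_eq_pow_mul hG₁_diff hG₁_eq hG_growth
  -- Hadamard's factorisation in genus zero
  obtain ⟨b, hb_sum, hb_prod⟩ :=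
    Literature.Analysis.Complex.hadamard_genus_zero_holds G₁ _ C₂ hG₁_diff hρ hC₂ hG₁0
  set c : ℕ → ℂ := fun n ↦ -b n with hc
  have hc_sum : Summable fun n ↦ ‖c n‖ := by simpa [hc] using hb_sum
  have hprod : ∀ z, HasProd (fun n ↦ 1 + c n * z ^ 2) (G₁ (z ^ 2) / G₁ 0) := fun z ↦ by
    have := hb_prod (z ^ 2)
    simpa [hc, sub_eq_add_neg] using this
  have hg_eq : ∀ z, g z = z ^ (2 * m) * (G₁ 0 * ∏' n, (1 + c n * z ^ 2)) := fun z ↦ by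
    rw [← hG_sq, hG₁_eq, (hprod z).tprod_eq, pow_mul]
    field_simp
  -- every factor-root gives the zeros `1/2 ± ζ` of `F`
  have hroot : ∀ n ζ, c n * ζ ^ 2 = -1 → F (1 / 2 + ζ) = 0 ∧ F (1 / 2 - ζ) = 0 := by
    intro n ζ hζ
    have hGz : G₁ (ζ ^ 2) = 0 := by
      have h0 : G₁ (ζ ^ 2) / G₁ 0 = 0 :=
        Newman.eq_zero_of_hasProd_of_eq_zero (hprod ζ) (k := n) (by rw [hζ]; ring)
      exact (div_eq_zero_iff.1 h0).resolve_right hG₁0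
    have hgζ : ∀ η, η ^ 2 = ζ ^ 2 → g η = 0 := fun η hη ↦ by
      rw [← hG_sq, hη, hG₁_eq, hGz, mul_zero]
    have h1 := hgζ ζ rfl
    have h2 := hgζ (-ζ) (by ring)
    simp only [hg] at h1 h2
    refine ⟨h1, ?_⟩
    rw [show (1 / 2 : ℂ) - ζ = 1 / 2 + -ζ by ring]
    exact h2
  refine ⟨m, c, hc_sum, hroot, fun τ hτ ↦ ?_⟩
  -- the point `z₀ = τ − 1/2`
  set z₀ : ℂ := (τ : ℂ) - 1 / 2 with hz₀
  have hz₀re : z₀.re = τ - 1 / 2 := by simp [hz₀]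
  have hz₀0 : z₀ ≠ 0 := by
    intro h
    have := congrArg Complex.re h
    rw [hz₀re, zero_re] at this
    linarith
  have hσz₀ : (1 / 2 : ℂ) + z₀ = τ := by simp [hz₀]
  have hgz₀ : g z₀ ≠ 0 := by
    simp only [hg]
    rw [hσz₀]
    exact hFne τ (by simpa using hτ)
  have hfac : ∀ n, 1 + c n * z₀ ^ 2 ≠ 0 := by
    intro n h
    apply hgz₀
    have h0 : G₁ (z₀ ^ 2) / G₁ 0 = 0 := Newman.eq_zero_of_hasProd_of_eq_zero (hprod z₀) h
    have hGz : G₁ (z₀ ^ 2) = 0 := (div_eq_zero_iff.1 h0).resolve_right hG₁0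
    rw [← hG_sq, hG₁_eq, hGz, mul_zero]
  refine ⟨hfac, ?_⟩
  -- `logDeriv F τ = logDeriv g z₀`
  have hlog1 : logDeriv F τ = logDeriv g z₀ := by
    have hcomp : g = F ∘ fun z ↦ 1 / 2 + z := rfl
    rw [hcomp, logDeriv_comp (by rw [hσz₀]; exact (hF _)) (((differentiable_const _).add differentiable_id) _),
      hσz₀]
    have hd : deriv (fun z : ℂ ↦ 1 / 2 + z) z₀ = 1 := by
      rw [deriv_const_add, deriv_id'']
    rw [hd, mul_one]
  -- `logDeriv g z₀` from the product
  have hP_diff : Differentiable ℂ (fun z ↦ ∏' n, (1 + c n * z ^ 2)) :=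
    differentiable_tprod_one_add_mul_sq hc_sum
  have hPz₀ : ∏' n, (1 + c n * z₀ ^ 2) ≠ 0 := tprod_one_add_mul_sq_ne_zero hc_sum hfac
  have hlog2 : logDeriv g z₀ = 2 * m / z₀ + ∑' n, 2 * c n * z₀ / (1 + c n * z₀ ^ 2) := by
    have hg_fun : g = fun z ↦ z ^ (2 * m) * (G₁ 0 * ∏' n, (1 + c n * z ^ 2)) := funext hg_eq
    rw [hg_fun, logDeriv_mul (f := fun z ↦ z ^ (2 * m)) (g := fun z ↦ G₁ 0 * ∏' n, (1 + c n * z ^ 2))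
        z₀ (pow_ne_zero _ hz₀0) (mul_ne_zero hG₁0 hPz₀) (differentiableAt_pow _)
        ((hP_diff z₀).const_mul _),
      logDeriv_const_mul (f := fun z ↦ ∏' n, (1 + c n * z ^ 2)) z₀ (G₁ 0) hG₁0,
      logDeriv_tprod_one_add_mul_sq hc_sum hfac]
    have hpow : logDeriv (fun z : ℂ ↦ z ^ (2 * m)) z₀ = 2 * m / z₀ := by
      rw [show (fun z : ℂ ↦ z ^ (2 * m)) = (· ^ (2 * m)) from rfl, logDeriv_pow]
      push_cast
      ring
    rw [hpow]
  rw [hlog1, hlog2]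

/-! ### Stark's Lemma 2: comparison of `Re 1/(σ − w)` at `σ` and at `σ₁` -/

/-- **Stark's Lemma 2 (with the constant `4`).** Let `0 < δ`, `1 ≤ σ ≤ σ₁ ≤ 1 + δ`, and let `w` with
`Re w ≤ 1` lie OUTSIDE the box `{Re w > 1 − δ, |Im w| < δ}`. Then `Re 1/(σ − w) ≤ 4 · Re 1/(σ₁ − w)`.
[cite: Stark1974, Lemma 2] -/
theorem re_inv_sub_le_four_mul {σ σ₁ δ : ℝ} {w : ℂ} (hδ : 0 < δ) (hσ : 1 ≤ σ) (hσσ₁ : σ ≤ σ₁)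
    (hσ₁ : σ₁ ≤ 1 + δ) (hw : w.re ≤ 1) (hbox : 1 - δ < w.re → δ ≤ |w.im|) :
    (((σ : ℂ) - w)⁻¹).re ≤ 4 * (((σ₁ : ℂ) - w)⁻¹).re := by
  set u : ℝ := σ - w.re with hu
  set u₁ : ℝ := σ₁ - w.re with hu₁
  set t : ℝ := w.im with ht
  have hu0 : 0 ≤ u := by rw [hu]; linarith
  have huu₁ : u ≤ u₁ := by rw [hu, hu₁]; linarith
  have hu₁le : u₁ ≤ u + δ := by rw [hu, hu₁]; linarith
  have hre : ((σ : ℂ) - w).re = u := by simp [hu]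
  have him : ((σ : ℂ) - w).im = -t := by simp [ht]
  have hre₁ : ((σ₁ : ℂ) - w).re = u₁ := by simp [hu₁]
  have him₁ : ((σ₁ : ℂ) - w).im = -t := by simp [ht]
  -- the two denominators are positive
  have hden : 0 < u * u + t * t := by
    rcases lt_or_eq_of_le hu0 with hpos | hzero
    · nlinarith [mul_self_nonneg t]
    · -- `u = 0`: then `Re w = σ ≥ 1`, so `Re w = 1 > 1 − δ`, hence `|t| ≥ δ > 0`
      have hwre : w.re = 1 := by rw [hu] at hzero; linarith
      have htδ : δ ≤ |t| := hbox (by rw [hwre]; linarith)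
      have ht0 : 0 < t * t := by
        have : 0 < |t| := lt_of_lt_of_le hδ htδ
        have h' : t ≠ 0 := abs_pos.mp this
        exact mul_self_pos.mpr h'
      nlinarith
  have hden₁ : 0 < u₁ * u₁ + t * t := by nlinarith
  rw [Complex.inv_re, Complex.inv_re, Complex.normSq_apply, Complex.normSq_apply, hre, him, hre₁, him₁,
    show -t * -t = t * t by ring]
  rw [div_le_iff₀ hden, show 4 * (u₁ / (u₁ * u₁ + t * t)) * (u * u + t * t) =
    4 * u₁ * (u * u + t * t) / (u₁ * u₁ + t * t) by ring, le_div_iff₀ hden₁]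
  -- goal: `u (u₁² + t²) ≤ 4 u₁ (u² + t²)`
  by_cases hcase : w.re ≤ 1 - δ
  · -- case A: `u ≥ δ`, so `u₁ ≤ 2u`
    have huδ : δ ≤ u := by rw [hu]; linarith
    have hu₁2 : u₁ ≤ 2 * u := by linarith
    have h1 : u * (u₁ * u₁) ≤ 4 * u₁ * (u * u) := by nlinarith [mul_nonneg hu0 (by linarith : 0 ≤ u₁)]
    have h2 : u * (t * t) ≤ 4 * u₁ * (t * t) := by nlinarith [mul_self_nonneg t]
    nlinarith
  · -- case B: `|t| ≥ δ`
    rw [not_le] at hcase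
    have htδ : δ ≤ |t| := hbox hcase
    have ht2 : δ * δ ≤ t * t := by
      have := mul_self_le_mul_self hδ.le htδ
      rwa [abs_mul_abs_self] at this
    have hu₁sq : u₁ * u₁ ≤ 2 * (u * u) + 2 * (t * t) := by
      have h1 : u₁ * u₁ ≤ (u + δ) * (u + δ) := mul_self_le_mul_self (by linarith) hu₁le
      nlinarith [mul_self_nonneg (u - δ)]
    have h3 : u * (u₁ * u₁ + t * t) ≤ 3 * u * (u * u + t * t) := by nlinarith [mul_self_nonneg t]
    have h4 : 3 * u * (u * u + t * t) ≤ 4 * u₁ * (u * u + t * t) := by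
      nlinarith [mul_self_nonneg t, mul_self_nonneg u]
    linarith

/-! ### The comparison theorem -/

/-- **`Re F'/F(σ) ≤ 4 Re F'/F(σ₁)`** ([Stark1974, Lemmas 2–3 combined]): let `F` be entire with
`F(1 − s) = F(s)`, `‖F(s)‖ ≤ C exp(‖s‖^μ)` for some `0 ≤ μ < 2`, all zeros in `Re s ≤ 1` and NO zero in
the box `{Re s > 1 − δ, |Im s| < δ}` (`0 < δ ≤ ½`). Then for `1 < σ ≤ σ₁ ≤ 1 + δ`,
`Re F'/F(σ) ≤ 4 · Re F'/F(σ₁)` (termwise in the Hadamard expansion; the zeros pair off as `ρ, 1 − ρ`,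
and `1 − ρ` is outside the box too, by symmetry). [cite: Stark1974, Lemma 4 (proof)] -/
theorem re_logDeriv_le_four_mul {F : ℂ → ℂ} (hF : Differentiable ℂ F)
    (hsymm : ∀ s, F (1 - s) = F s) {C μ : ℝ} (hμ : μ < 2) (hμ0 : 0 ≤ μ)
    (hgrowth : ∀ s, ‖F s‖ ≤ C * Real.exp (‖s‖ ^ μ)) (hzero : ∀ s, F s = 0 → s.re ≤ 1)
    {δ : ℝ} (hδ : 0 < δ) (hδ1 : δ ≤ 1 / 2)
    (hbox : ∀ s, F s = 0 → 1 - δ < s.re → δ ≤ |s.im|)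
    {σ σ₁ : ℝ} (hσ : 1 < σ) (hσσ₁ : σ ≤ σ₁) (hσ₁ : σ₁ ≤ 1 + δ) :
    (logDeriv F σ).re ≤ 4 * (logDeriv F σ₁).re := by
  obtain ⟨m, c, hc, hroots, hrep⟩ := exists_hadamard_logDeriv hF hsymm hμ hμ0 hgrowth hzero
  obtain ⟨hfac, hlog⟩ := hrep σ hσ
  obtain ⟨hfac₁, hlog₁⟩ := hrep σ₁ (by linarith)
  have hsum := summable_logDeriv_terms hc ((σ : ℂ) - 1 / 2)
  have hsum₁ := summable_logDeriv_terms hc ((σ₁ : ℂ) - 1 / 2)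
  have hsumre : Summable fun n ↦ (2 * c n * ((σ : ℂ) - 1 / 2) / (1 + c n * ((σ : ℂ) - 1 / 2) ^ 2)).re :=
    (Complex.hasSum_re hsum.hasSum).summable
  have hsumre₁ : Summable fun n ↦
      4 * (2 * c n * ((σ₁ : ℂ) - 1 / 2) / (1 + c n * ((σ₁ : ℂ) - 1 / 2) ^ 2)).re :=
    ((Complex.hasSum_re hsum₁.hasSum).summable).mul_left 4
  rw [hlog, hlog₁, add_re, add_re, Complex.re_tsum hsum, Complex.re_tsum hsum₁, mul_add, ← tsum_mul_left]
  -- the pole term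
  have hm0 : (0 : ℝ) ≤ m := Nat.cast_nonneg m
  have h1 : (2 * (m : ℂ) / ((σ : ℂ) - 1 / 2)).re ≤ 4 * (2 * (m : ℂ) / ((σ₁ : ℂ) - 1 / 2)).re := by
    rw [show (2 * (m : ℂ) / ((σ : ℂ) - 1 / 2)) = ((2 * m / (σ - 1 / 2) : ℝ) : ℂ) by push_cast; ring,
      show (2 * (m : ℂ) / ((σ₁ : ℂ) - 1 / 2)) = ((2 * m / (σ₁ - 1 / 2) : ℝ) : ℂ) by push_cast; ring,
      ofReal_re, ofReal_re]
    rw [div_le_iff₀ (by linarith), show 4 * (2 * (m : ℝ) / (σ₁ - 1 / 2)) * (σ - 1 / 2) =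
      (8 * m * (σ - 1 / 2)) / (σ₁ - 1 / 2) by ring, le_div_iff₀ (by linarith)]
    nlinarith
  -- the zero terms
  have h2 : ∑' n, (2 * c n * ((σ : ℂ) - 1 / 2) / (1 + c n * ((σ : ℂ) - 1 / 2) ^ 2)).re ≤
      ∑' n, 4 * (2 * c n * ((σ₁ : ℂ) - 1 / 2) / (1 + c n * ((σ₁ : ℂ) - 1 / 2) ^ 2)).re := by
    refine Summable.tsum_le_tsum (fun n ↦ ?_) hsumre hsumre₁
    by_cases hn : c n = 0
    · simp [hn]
    · set ζ : ℂ := (-(c n)⁻¹) ^ (2⁻¹ : ℂ) with hζdef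
      have hζ : c n * ζ ^ 2 = -1 := by
        rw [hζdef, cpow_ofNat_inv_pow _ 2]
        field_simp
      obtain ⟨hwp, hwm⟩ := hroots n ζ hζ
      rw [term_eq_inv_add_inv hζ (hfac n), term_eq_inv_add_inv hζ (hfac₁ n), add_re, add_re, mul_add,
        show (σ : ℂ) - 1 / 2 - ζ = (σ : ℂ) - (1 / 2 + ζ) by ring,
        show (σ : ℂ) - 1 / 2 + ζ = (σ : ℂ) - (1 / 2 - ζ) by ring,
        show (σ₁ : ℂ) - 1 / 2 - ζ = (σ₁ : ℂ) - (1 / 2 + ζ) by ring,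
        show (σ₁ : ℂ) - 1 / 2 + ζ = (σ₁ : ℂ) - (1 / 2 - ζ) by ring]
      exact add_le_add
        (re_inv_sub_le_four_mul hδ hσ.le hσσ₁ hσ₁ (hzero _ hwp) (hbox _ hwp))
        (re_inv_sub_le_four_mul hδ hσ.le hσσ₁ hσ₁ (hzero _ hwm) (hbox _ hwm))
  linarith

end Residue

end Summit.QuantumAdvantage.QuantumAdvantage.Theorems.DegreeOnePrimesEscape

end
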